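import Summits.NavierStokesRegularity.NavierStokesRegularity.Theorems.HeredityAtOne.Negative.HeredityAtOneFalseOfCappedStageAtOne
import Summits.NavierStokesRegularity.FluidComputer.AxisymNoSwirlForcedGlobal

/-!
# `ForcedNoSwirlGlobal` HOLDS — the `H_LUY` hypothesis of the swirl-free stratum lemmas is discharged

Cell `ns-blowup`, seat `ns-blowup-refuter5` (g0), K-row K5-08 (at-ACCEPT read of p448312 §3 against
ns-blowup-lean g9's p453245 `FluidComputer/AxisymNoSwirlForcedGlobal.lean`). LABEL: NEGATIVE-LANE HELPER,
kernel; no Theses decl is asserted; no stage, flow or tower is constructed. WHAT THIS IS NOT: not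
Navier–Stokes evidence about blow-up and not a refutation of any item — the remaining hypothesis of every
corollary below is the OPEN witness class `NoSwirlRung k₀` (an axisymmetric swirl-free pinned rigid quiet
wide design carrying a registered level-`k₀` stage), which the same theorem shows to be EMPTY as soon as
`EpisodeInductionG` holds (`EpisodeInductionG.isEmpty_noSwirl_stage`).

p448312 (`HeredityAtOneFalseOfCappedStageAtOne` §3) typed the forced Ladyzhenskaya–Ukhovskii–Yudovich
statement as a HYPOTHESIS `ForcedNoSwirlGlobal` («in print, not yet typed in the tree»). It is now a
theorem of the tree: `Summit.NavierStokesRegularity.FluidComputer.exists_claySolution_of_axisym_noSwirl`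
(p453245; the Clay dichotomy `exists_claySolution_or_clayBlowup` with the blow-up branch emptied by the
forced swirl-free regularity chain) gives, for a Clay datum and Clay force that are axisymmetric without
swirl, a global solution `(u, p)` jointly smooth on `[0, ∞) × ℝ³` with bounded energy; the field-by-field
bridge `isNavierStokesSolution_and_smooth_iff` turns it into `IsClassicalNSSolutionOn (Ici 0) 1 f u p ∧
u 0 = u₀`, which is `ForcedNoSwirlGlobal` verbatim at `ν = 1`.

* `forcedNoSwirlGlobal_holds : ForcedNoSwirlGlobal`;
* the two §3 statements of p448312 phrased over its witness class `NoSwirlRung`, with `hL` discharged: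
  `NoSwirlRung.not_heredityFrom` (every `k₀`) and `not_noSwirlRung_of_heredityAtOne_of_heredityFrom_two`.
  The remaining §3 corollaries (`episodeInduction_false_of_noSwirlRung`,
  `heredityAtOne_and_heredityFromTwo_false_of_noSwirlRung`, `isEmpty_noSwirl_stage_of_episodeInductionG`)
  become hypothesis-free by substituting `forcedNoSwirlGlobal_holds` for `hL`; they are NOT restated here
  because ns-blowup-lean g9 has already landed their explicit-binder twins
  (`EpisodeInductionG.isEmpty_stage_of_noSwirl_forced`, `not_episodeInductionG_of_noSwirl_forced_design`,
  `PalasekTowerBreakdownNegative.palasekTowerBreakdown_not_episodeInduction_of_noSwirl_forced_design`,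
  `…_not_heredity_pair_of_noSwirl_forced_design`; p453946 / p455005).

References: P. G. Lemarié-Rieusset, *The Navier–Stokes Problem in the 21st Century* (2016), Thm. 10.4
[cite: LemarieRieusset2016, Thm. 10.4 (p. 285)]; S. Palasek, arXiv:2605.13827 §4
[cite: Palasek2026ElementaryModel, §4].
-/

noncomputable section

namespace Summit.NavierStokesRegularity.HeredityAtOneSpeedCap

open Set MeasureTheory
open Literature.Analysis.FluidPDE
open Summit.NavierStokesRegularity.FluidComputer.PalasekTowerClayBridge
open Summit.NavierStokesRegularity.NavierStokesRegularity

/-- **Forced Ladyzhenskaya–Ukhovskii–Yudovich, classical rendering, HOLDS**: for a smooth divergence-free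
rapidly decaying axisymmetric swirl-free datum and a Clay-class force axisymmetric without swirl at all
`t ≥ 0`, the Navier–Stokes system at unit viscosity has a global classical solution from the datum with
bounded energy (from `exists_claySolution_of_axisym_noSwirl`, p453245, via
`isNavierStokesSolution_and_smooth_iff`). [cite: LemarieRieusset2016, Thm. 10.4 (p. 285)] -/
theorem forcedNoSwirlGlobal_holds : ForcedNoSwirlGlobal := by
  intro u₀ f hu₀ hdiv hdec hA hS hs hd hf
  obtain ⟨u, p, hU, hP, hns, hE⟩ :=
    Summit.NavierStokesRegularity.FluidComputer.exists_claySolution_of_axisym_noSwirl one_pos hu₀ hdiv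
      hdec hs hd hA hS (fun t ht => (hf t ht).1) (fun t ht => (hf t ht).2)
  have hcl := isNavierStokesSolution_and_smooth_iff.1 ⟨hns, hU, hP⟩
  exact ⟨u, p, hcl.1, hcl.2, hE⟩

/-- **`H_𝒮(k₀) → ¬ HeredityFrom k₀`, now with `H_LUY` discharged**: an axisymmetric swirl-free pinned rigid
quiet wide design carrying a registered level-`k₀` stage refutes heredity from `k₀` (every `k₀`; at
`k₀ = 0` this is weaker than `FirstEpisodeHoldRelease.not_heredityFrom_zero`, at `k₀ ≥ 1` it is the
`NoSwirlRung`-packaged form of ns-blowup-lean g9's explicit-binder theorems).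
[cite: LemarieRieusset2016, Thm. 10.4 (p. 285)] -/
theorem NoSwirlRung.not_heredityFrom {k₀ : ℕ} (hW : NoSwirlRung k₀) : ¬ HeredityFrom k₀ :=
  not_heredityFrom_of_noSwirlRung forcedNoSwirlGlobal_holds hW

/-- `HeredityAtOne ∧ HeredityFrom 2` leaves no room for a swirl-free registered stage at any level `≥ 1`,
with `H_LUY` discharged. [cite: LemarieRieusset2016, Thm. 10.4 (p. 285)] -/
theorem not_noSwirlRung_of_heredityAtOne_of_heredityFrom_two (h₁ : HeredityAtOne) (h₂ : HeredityFrom 2)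
    {k₀ : ℕ} (hk : 1 ≤ k₀) : ¬ NoSwirlRung k₀ :=
  not_noSwirlRung_of_heredity forcedNoSwirlGlobal_holds h₁ h₂ hk

end Summit.NavierStokesRegularity.HeredityAtOneSpeedCap

end
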